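import Summits.MatrixMultiplication.OmegaCensus.SmallFormats.MatMul22nLoadedPlaneStructure
import HarnessLib

/-!
# ω-census family (a): OBSTRUCTION COMBINATORICS on `Fin 4` — no `(2,2)` rows or columns under the normal-form clause

Cell `pub-omega` (unit `pub-omega-tensor`, gen 40), topic `Summits/MatrixMultiplication/OmegaCensus` (sub-folder
`SmallFormats`). Framing (verbatim): lottery ticket; floor = certified bounds/negative ranges. HONEST FRAMING: M1-LEAN-BLUEPRINT step (a) (memo DEFLATION-g40 §3, the A5
combinatorics): for line maps `L L' : Fin 4 → Fin 4 → Fin 4` (rows / columns), each non-injective without triple coincidences, satisfying the obstruction clause of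
`M1Structure.structure_package` («a row pair avoiding `μ` and a column pair of `μ` force `v` onto that column pair's line»), NO row has two disjoint coincident pairs
(`ObstructionComb.no_two_two_row`), and dually for columns via the dual clause (`dualNF_of_NF`, `no_two_two_col`). Pure finite combinatorics. Nothing on `ω`.
-/

namespace Summit.MatrixMultiplication.OmegaCensus.SmallFormats

open Finset

namespace ObstructionComb

set_option maxRecDepth 40000 in
/-- One column: if every pair of the column's line map must contain `v`'s line (the NF consequence) then `v` has a UNIQUE partner on its line. (decide) -/
theorem partner_of_column (v : Fin 4) (f : Fin 4 → Fin 4) (hni : ∃ a b : Fin 4, a ≠ b ∧ f a = f b)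
    (hnt : ∀ a b d : Fin 4, a ≠ b → a ≠ d → b ≠ d → ¬ (f a = f b ∧ f a = f d))
    (hNF : ∀ a' b' : Fin 4, a' ≠ b' → f a' = f b' → f v = f a') :
    ∃ x : Fin 4, x ≠ v ∧ f x = f v ∧ ∀ y : Fin 4, y ≠ v → f y = f v → y = x := by
  revert v f
  decide

/-- Pigeonhole: a function `x : Fin 4 → Fin 4` avoiding `v` cannot take each of the three other values on (at least) the two-element complement of a pair. -/
theorem pigeonhole (v : Fin 4) (x : Fin 4 → Fin 4) (p q : Fin 4 → Fin 4) (hpq : ∀ w, w ≠ v → p w ≠ q w)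
    (hfib : ∀ w, w ≠ v → ∀ μ, μ ≠ p w → μ ≠ q w → x μ = w) : False := by
  classical
  -- each w ≠ v has a fibre of size ≥ 2; the three fibres are disjoint subsets of Fin 4
  have hcomp : ∀ w, w ≠ v → 2 ≤ (Finset.univ.filter fun μ => x μ = w).card := by
    intro w hw
    -- the complement of {p w, q w} has two elements μ₁ ≠ μ₂
    have : 2 ≤ ((Finset.univ : Finset (Fin 4)) \ {p w, q w}).card := by
      have h2 : ({p w, q w} : Finset (Fin 4)).card = 2 := by
        rw [Finset.card_insert_of_notMem (by simpa using hpq w hw), Finset.card_singleton]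
      rw [Finset.card_univ_sdiff, h2]; decide
    refine this.trans (Finset.card_le_card fun μ hμ => ?_)
    rw [Finset.mem_sdiff, Finset.mem_insert, Finset.mem_singleton, not_or] at hμ
    rw [Finset.mem_filter]
    exact ⟨Finset.mem_univ _, hfib w hw μ hμ.2.1 hμ.2.2⟩
  have hdisj : ∀ w w', w ≠ w' → Disjoint (Finset.univ.filter fun μ => x μ = w) (Finset.univ.filter fun μ => x μ = w') := by
    intro w w' hww'
    rw [Finset.disjoint_filter]
    intro μ _ h1 h2; exact hww' (h1.symm.trans h2)
  have hsum : ((Finset.univ.erase v).biUnion fun w => Finset.univ.filter fun μ => x μ = w).card =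
      ∑ w ∈ Finset.univ.erase v, (Finset.univ.filter fun μ => x μ = w).card :=
    Finset.card_biUnion fun w _ w' _ h => hdisj w w' h
  have hle : ((Finset.univ.erase v).biUnion fun w => Finset.univ.filter fun μ => x μ = w).card ≤ 4 :=
    (Finset.card_le_univ _).trans (by simp)
  have hge : 6 ≤ ∑ w ∈ Finset.univ.erase v, (Finset.univ.filter fun μ => x μ = w).card := by
    have h3 : (Finset.univ.erase v).card = 3 := by rw [Finset.card_erase_of_mem (Finset.mem_univ v)]; simp
    calc 6 = ∑ _w ∈ Finset.univ.erase v, 2 := by rw [Finset.sum_const, h3]; rfl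
      _ ≤ _ := Finset.sum_le_sum fun w hw => hcomp w (Finset.ne_of_mem_erase hw)
  omega

/-- **No `(2,2)` row.** Rows `L`, columns `L'` (non-injective, columns without triples) with the obstruction clause: no row has two disjoint coincident pairs. -/
theorem no_two_two_row (L L' : Fin 4 → Fin 4 → Fin 4) (hRni : ∀ v, ∃ a b : Fin 4, a ≠ b ∧ L v a = L v b)
    (hCni : ∀ μ, ∃ a b : Fin 4, a ≠ b ∧ L' μ a = L' μ b)
    (hCnt : ∀ μ a b d, a ≠ b → a ≠ d → b ≠ d → ¬ (L' μ a = L' μ b ∧ L' μ a = L' μ d))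
    (hNF : ∀ v μ a bb a' bb', a ≠ bb → L v a = L v bb → μ ≠ a → μ ≠ bb → a' ≠ bb' → L' μ a' = L' μ bb' → L' μ v = L' μ a')
    (v a bb cc dd : Fin 4) (hab : a ≠ bb) (hac : a ≠ cc) (had : a ≠ dd) (hbc : bb ≠ cc) (hbd : bb ≠ dd) (hcd : cc ≠ dd)
    (h1 : L v a = L v bb) (h2 : L v cc = L v dd) : False := by
  classical
  -- every column misses one of the two pairs
  have hcov : ∀ μ : Fin 4, ∃ e f : Fin 4, e ≠ f ∧ L v e = L v f ∧ μ ≠ e ∧ μ ≠ f := by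
    intro μ
    by_cases hμ : μ = a ∨ μ = bb
    · refine ⟨cc, dd, hcd, h2, ?_, ?_⟩ <;> rcases hμ with rfl | rfl
      · exact hac
      · exact hbc
      · exact had
      · exact hbd
    · push Not at hμ
      exact ⟨a, bb, hab, h1, hμ.1, hμ.2⟩
  have hNFv : ∀ μ a' b', a' ≠ b' → L' μ a' = L' μ b' → L' μ v = L' μ a' := by
    intro μ a' b' h h'
    obtain ⟨e, f, hef, hL, hμe, hμf⟩ := hcov μ
    exact hNF v μ e f a' b' hef hL hμe hμf h h'
  have hpart : ∀ μ, ∃ x : Fin 4, x ≠ v ∧ L' μ x = L' μ v ∧ ∀ y : Fin 4, y ≠ v → L' μ y = L' μ v → y = x :=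
    fun μ => partner_of_column v (L' μ) (hCni μ) (hCnt μ) (hNFv μ)
  choose x hxv hxL hxu using hpart
  choose p q hpq hLpq using hRni
  refine pigeonhole v x p q (fun w _ => hpq w) fun w hw μ hμp hμq => ?_
  -- NF for row w (pair p w, q w) and column μ (pair x μ, v)
  have h := hNF w μ (p w) (q w) (x μ) v (hpq w) (hLpq w) hμp hμq (hxv μ) (hxL μ)
  exact (hxu μ w hw (h.trans (hxL μ))).symm

/-- The DUAL clause follows from the clause and «no triple» in the columns. -/
theorem dualNF_of_NF (L L' : Fin 4 → Fin 4 → Fin 4)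
    (hCnt : ∀ μ a b d, a ≠ b → a ≠ d → b ≠ d → ¬ (L' μ a = L' μ b ∧ L' μ a = L' μ d))
    (hNF : ∀ v μ a bb a' bb', a ≠ bb → L v a = L v bb → μ ≠ a → μ ≠ bb → a' ≠ bb' → L' μ a' = L' μ bb' → L' μ v = L' μ a')
    (μ v a' bb' a bb : Fin 4) (hab' : a' ≠ bb') (hL' : L' μ a' = L' μ bb') (hva : v ≠ a') (hvb : v ≠ bb') (hab : a ≠ bb)
    (hL : L v a = L v bb) : L v μ = L v a := by
  by_contra hne
  have hμa : μ ≠ a := fun h => hne (by rw [h])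
  have hμb : μ ≠ bb := fun h => hne (by rw [h, ← hL])
  have h := hNF v μ a bb a' bb' hab hL hμa hμb hab' hL'
  exact hCnt μ a' bb' v hab' (Ne.symm hva) (Ne.symm hvb) ⟨hL', h.symm⟩

/-- **No `(2,2)` column** (the dual statement; rows without triples needed as well). -/
theorem no_two_two_col (L L' : Fin 4 → Fin 4 → Fin 4) (hRni : ∀ v, ∃ a b : Fin 4, a ≠ b ∧ L v a = L v b)
    (hCni : ∀ μ, ∃ a b : Fin 4, a ≠ b ∧ L' μ a = L' μ b)
    (hRnt : ∀ v a b d, a ≠ b → a ≠ d → b ≠ d → ¬ (L v a = L v b ∧ L v a = L v d))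
    (hCnt : ∀ μ a b d, a ≠ b → a ≠ d → b ≠ d → ¬ (L' μ a = L' μ b ∧ L' μ a = L' μ d))
    (hNF : ∀ v μ a bb a' bb', a ≠ bb → L v a = L v bb → μ ≠ a → μ ≠ bb → a' ≠ bb' → L' μ a' = L' μ bb' → L' μ v = L' μ a')
    (μ a bb cc dd : Fin 4) (hab : a ≠ bb) (hac : a ≠ cc) (had : a ≠ dd) (hbc : bb ≠ cc) (hbd : bb ≠ dd) (hcd : cc ≠ dd)
    (h1 : L' μ a = L' μ bb) (h2 : L' μ cc = L' μ dd) : False :=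
  no_two_two_row L' L hCni hRni hRnt
    (fun V M a' bb' a'' bb'' hab' hL' hva hvb hab'' hL'' => dualNF_of_NF L L' hCnt hNF V M a' bb' a'' bb'' hab' hL' hva hvb hab'' hL'')
    μ a bb cc dd hab hac had hbc hbd hcd h1 h2

end ObstructionComb

end Summit.MatrixMultiplication.OmegaCensus.SmallFormats
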